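import Summits.CriticalPhenomena.CardyFormulaZ2.Theorems.CardyGluingRDEGluingContractionOfRate
import Summits.CriticalPhenomena.CardyFormulaZ2.Theorems.CardyGluingRDEContractionGivesMerging

/-!
# Crux `GluingContraction` (stmt-CriticalPhenomena-8580): the two honest hypotheses, typed
(lead c3-0, line `registered` dead; companion of `Lines/registered_dead.md`)

`RateMergingLevel` = the conjunction (H_Z ∧ H_T) of `GluingContraction_of_levelRate` (landed p150075):
a POWER-LAW RATE for the bond-`ℤ²` level-`j` segment-matrix law to a common limit `π δ₀ j`
(`½ Σ_M |P_ℤ²(E^Z_M) − π_M| ≤ A·2^{γ j}·(u/δ₀)^α`, `0 < u ≤ δ₀`) and mere CONVERGENCE of the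
site-`𝕋` law to the same limit.  `RateMergingUniform` = the `θ = 0` uniform-rate form.
Below: both imply the crux (one line each over the landed theorems) and hence `BoxMerging`
(over the landed `ContractionGivesMerging_proof`).  These are the objects a re-lined crux should
name: H_T is Camia–Newman strength (fileable), H_Z is the open problem (rate-universality for ℤ²).
No `sorry`; nothing here is new mathematics — it only types the sandwich
`RateMergingLevel ⟹ RateMergingUniform-type bound ⟹ GluingContraction ⟹ BoxMerging`.
-/

namespace Summit.CriticalPhenomena.CardyFormulaZ2.Cruxes.GluingContraction.Registered

open Summit.CriticalPhenomena.CardyFormulaZ2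

/-- H_Z ∧ H_T in the route's inlined vocabulary (hypothesis of `Theorems.GluingContraction_of_levelRate`). -/
def RateMergingLevel : Prop :=
  let PZ := Literature.Probability.Percolation.bondPercolation (Literature.Probability.LatticeModels.zdGraph 2) Literature.Probability.Percolation.half; let PT := Literature.Probability.LatticeModels.triSitePercolation Literature.Probability.Percolation.half; let Sq : ℝ → Set ℂ := fun δ₀ => {z : ℂ | 0 < z.re ∧ z.re < δ₀ ∧ 0 < z.im ∧ z.im < δ₀}; let seg : (δ₀ : ℝ) → (j : ℕ) → Fin 4 × Fin (2 ^ j) → Set ℂ := fun δ₀ j a => {z : ℂ | (a.1 = 0 ∧ z.im = 0 ∧ δ₀ * ((a.2 : ℕ) : ℝ) / 2 ^ j ≤ z.re ∧ z.re ≤ δ₀ * (((a.2 : ℕ) : ℝ) + 1) / 2 ^ j) ∨ (a.1 = 1 ∧ z.re = δ₀ ∧ δ₀ * ((a.2 : ℕ) : ℝ) / 2 ^ j ≤ z.im ∧ z.im ≤ δ₀ * (((a.2 : ℕ) : ℝ) + 1) / 2 ^ j) ∨ (a.1 = 2 ∧ z.im = δ₀ ∧ δ₀ * ((a.2 : ℕ)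 : ℝ) / 2 ^ j ≤ z.re ∧ z.re ≤ δ₀ * (((a.2 : ℕ) : ℝ) + 1) / 2 ^ j) ∨ (a.1 = 3 ∧ z.re = 0 ∧ δ₀ * ((a.2 : ℕ) : ℝ) / 2 ^ j ≤ z.im ∧ z.im ≤ δ₀ * (((a.2 : ℕ) : ℝ) + 1) / 2 ^ j)}; let EZ : (δ₀ : ℝ) → (j : ℕ) → ℝ → ((Fin 4 × Fin (2 ^ j)) → (Fin 4 × Fin (2 ^ j)) → Bool) → Set (Literature.Probability.Percolation.BondConfig (Literature.Probability.LatticeModels.Site 2)) := fun δ₀ j u M => {ω | ∀ a b, ω ∈ Literature.Probability.Percolation.discreteCrossing (Sq δ₀) u (seg δ₀ j a) (seg δ₀ j b) ↔ M a b = true}; let ET : (δ₀ : ℝ) → (j : ℕ) → ℝ → ((Fin 4 × Fin (2 ^ j)) → (Fin 4 × Fin (2 ^ j)) → Bool) → Set (Literature.Probability.Percolation.SiteConfig (Literature.Probability.LatticeModels.Site 2)) := fun δ₀ j u M => {ω | ∀ a b, ω ∈ Literature.Probability.LatticeModels.triCrossing (Sq δ₀) u (seg δ₀ j a) (seg δ₀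 j b) ↔ M a b = true}; ∃ α A γ : ℝ, 0 < α ∧ 0 ≤ A ∧ 0 ≤ γ ∧ ∃ π : (δ₀ : ℝ) → (j : ℕ) → ((Fin 4 × Fin (2 ^ j)) → (Fin 4 × Fin (2 ^ j)) → Bool) → ℝ, (∀ δ₀ : ℝ, 0 < δ₀ → ∀ (j : ℕ) (u : ℝ), 0 < u → u ≤ δ₀ → (1 / 2 : ℝ) * ∑ M : (Fin 4 × Fin (2 ^ j)) → (Fin 4 × Fin (2 ^ j)) → Bool, |PZ.real (EZ δ₀ j u M) - π δ₀ j M| ≤ A * (2 : ℝ) ^ (γ * (j : ℝ)) * (u / δ₀) ^ α) ∧ (∀ δ₀ : ℝ, 0 < δ₀ → ∀ (j : ℕ) (ε : ℝ), 0 < ε → ∃ δT : ℝ, 0 < δT ∧ ∀ u' : ℝ, 0 < u' → u' ≤ δT → (1 / 2 : ℝ) * ∑ M : (Fin 4 × Fin (2 ^ j)) → (Fin 4 × Fin (2 ^ j)) → Bool, |PT.real (ET δ₀ j u' M) - π δ₀ j M| ≤ ε)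

/-- The `θ = 0` uniform-rate statement (hypothesis of `Theorems.GluingContraction_of_uniformRate`). -/
def RateMergingUniform : Prop :=
  let PZ := Literature.Probability.Percolation.bondPercolation (Literature.Probability.LatticeModels.zdGraph 2) Literature.Probability.Percolation.half; let PT := Literature.Probability.LatticeModels.triSitePercolation Literature.Probability.Percolation.half; let Sq : ℝ → Set ℂ := fun δ₀ => {z : ℂ | 0 < z.re ∧ z.re < δ₀ ∧ 0 < z.im ∧ z.im < δ₀}; let seg : (δ₀ : ℝ) → (j : ℕ) → Fin 4 × Fin (2 ^ j) → Set ℂ := fun δ₀ j a => {z : ℂ | (a.1 = 0 ∧ z.im = 0 ∧ δ₀ * ((a.2 : ℕ) : ℝ) / 2 ^ j ≤ z.re ∧ z.re ≤ δ₀ * (((a.2 : ℕ) : ℝ) + 1) / 2 ^ j) ∨ (a.1 = 1 ∧ z.re = δ₀ ∧ δ₀ * ((a.2 : ℕ) : ℝ) / 2 ^ j ≤ z.im ∧ z.im ≤ δ₀ * (((a.2 : ℕ) : ℝ) + 1) / 2 ^ j) ∨ (a.1 = 2 ∧ z.im = δ₀ ∧ δ₀ * ((a.2 : ℕ) : ℝ)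 / 2 ^ j ≤ z.re ∧ z.re ≤ δ₀ * (((a.2 : ℕ) : ℝ) + 1) / 2 ^ j) ∨ (a.1 = 3 ∧ z.re = 0 ∧ δ₀ * ((a.2 : ℕ) : ℝ) / 2 ^ j ≤ z.im ∧ z.im ≤ δ₀ * (((a.2 : ℕ) : ℝ) + 1) / 2 ^ j)}; let EZ : (δ₀ : ℝ) → (j : ℕ) → ℝ → ((Fin 4 × Fin (2 ^ j)) → (Fin 4 × Fin (2 ^ j)) → Bool) → Set (Literature.Probability.Percolation.BondConfig (Literature.Probability.LatticeModels.Site 2)) := fun δ₀ j u M => {ω | ∀ a b, ω ∈ Literature.Probability.Percolation.discreteCrossing (Sq δ₀) u (seg δ₀ j a) (seg δ₀ j b) ↔ M a b = true}; let ET : (δ₀ : ℝ) → (j : ℕ) → ℝ → ((Fin 4 × Fin (2 ^ j)) → (Fin 4 × Fin (2 ^ j)) → Bool) → Set (Literature.Probability.Percolation.SiteConfig (Literature.Probability.LatticeModels.Site 2)) := fun δ₀ j u M => {ω | ∀ a b, ω ∈ Literature.Probability.LatticeModels.triCrossing (Sq δ₀) u (seg δ₀ j a) (seg δ₀ j b)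 ↔ M a b = true}; let TV : ℝ → ℕ → ℝ → ℝ → ℝ := fun δ₀ j u u' => (1 / 2 : ℝ) * ∑ M : (Fin 4 × Fin (2 ^ j)) → (Fin 4 × Fin (2 ^ j)) → Bool, |PZ.real (EZ δ₀ j u M) - PT.real (ET δ₀ j u' M)|; let Dw : ℝ → ℝ → ℕ → ℝ → ℝ → ℝ := fun σ δ₀ K u u' => ∑ j ∈ Finset.range (K + 1), (2 : ℝ) ^ (-(σ * (j : ℝ))) * TV δ₀ j u u'; ∃ σ C κ : ℝ, 0 < σ ∧ 0 < C ∧ 0 < κ ∧ ∀ δ₀ : ℝ, 0 < δ₀ → ∀ K : ℕ, ∃ δT : ℝ, 0 < δT ∧ ∀ u u' : ℝ, 0 < u → u ≤ δ₀ / (C * 2 ^ K) → 0 < u' → u' ≤ δT → Dw σ δ₀ K u u' ≤ C * (2 : ℝ) ^ (-(κ * (K : ℝ)))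

/-- `RateMergingUniform → GluingContraction` (landed, p150075). -/
theorem gluingContraction_of_rateMergingUniform (h : RateMergingUniform) :
    Theses.CardyGluingRDE.GluingContraction :=
  Theorems.GluingContraction_of_uniformRate h

/-- `RateMergingLevel → GluingContraction` (landed, p150075). -/
theorem gluingContraction_of_rateMergingLevel (h : RateMergingLevel) :
    Theses.CardyGluingRDE.GluingContraction :=
  Theorems.GluingContraction_of_levelRate h

/-- `RateMergingLevel → BoxMerging` (through the crux and the landed `ContractionGivesMerging_proof`). -/
theorem boxMerging_of_rateMergingLevel (h : RateMergingLevel) : Theses.CardyGluingRDE.BoxMerging :=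
  Theorems.ContractionGivesMerging_proof (gluingContraction_of_rateMergingLevel h)

end Summit.CriticalPhenomena.CardyFormulaZ2.Cruxes.GluingContraction.Registered
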